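import Summits.KontsevichZagierPeriods.KontsevichZagierPeriods.Theorems.SymplecticScissorsRealOnePeriodRelationsStubRetractionCases

/-!
# `RealOnePeriodRelations` (stmt-KontsevichZagierPeriods-10042), line `nash-retraction-thin-strip`:
# stub `stub_retraction` — the retraction `Θ` kills Huber–Wüstholz's elementary relations

Given (hypotheses, verbatim the statements of the neighbouring stubs of the lead skeleton
`Cruxes/RealOnePeriodRelations/Lines/nash-retraction-thin-strip.lean`)

1. SEMIALGEBRAIC REPRESENTATIVES (`stub_saHomotopic`): every `C¹` path on a smooth affine curve
   over `ℚ̄` is homotopic with fixed end points to a `ℚ`-semialgebraic `C¹` path;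
2. HOMOTOPY COHERENCE (`stub_homotopyInvariance`): homotopic semialgebraic paths realise `a·ω`
   equally modulo `M₁`;
3. EXACTNESS IN DIMENSION ONE (`stub_exactDimOne`);
4. REALISATIONS EXIST (`stub_realises`);

we DEFINE `Θ a (Z, ω, γ) := [∫₀¹ Re(a · ω(γ̃) γ̃′) dt]` for algebraic `a` (and `0` otherwise), where
`γ̃` is a CHOSEN semialgebraic representative of the homotopy class of `γ` (choice from 1) and the
representation is chosen by 4, and prove:

* (i) `Θ` kills every `ℚ̄`-combination `Σₗ aₗ • ρₗ` of elementary relations modulo `M₁`: by the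
  additive extension of `RetractionAlgebra` it suffices to treat `a • ρ` for one relation `ρ` and
  one algebraic `a`, written as a formal sum `Σⱼ bⱼ • δ_{sⱼ}`; (R1) `add`/`smul` are rule 1b along
  the common representative (`realises_add_form`, `realises_smul_form`), (R2) `vanish` is a zero
  integrand (`realises_vanish`), (R3) `exact`, (R4) `pushforward`, (R5) `boundary` are
  `RetractionCases.exact_case / pushforward_case / boundary_case`, the needed homotopies coming
  from the chosen representatives (`RetractionPaths`, `RetractionConcat`);
* (ii) `Θ a s` agrees modulo `M₁` with any realisation of `a·s` along `s.γ` when `s.γ` is itself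
  semialgebraic (coherence between `γ̃` and `γ`).

References: A. Huber, G. Wüstholz, *Transcendence and Linear Relations of 1-Periods* (2022),
Thm 13.3 (2), §13.1, §3.3.1; M. Kontsevich, D. Zagier, *Periods* (2001), §1.2.
-/

noncomputable section

open scoped BigOperators unitInterval
open Set MeasureTheory MvPolynomial
open Literature.NumberTheory.Transcendental Literature.NumberTheory.Transcendental.CurvePeriods
open Literature.ModelTheory.ExponentialFields (IsSemialgebraic)
open Summit.KontsevichZagierPeriods.SymplecticScissors.RealOnePeriodRelationsNegative (M₁ unitDom)

namespace Summit.KontsevichZagierPeriods.SymplecticScissors.RealOnePeriodRelations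

namespace Retraction

/-- `a • (Σⱼ bⱼ • xⱼ) = Σⱼ (a bⱼ) • xⱼ` for finitely supported combinations. [folklore] -/
theorem smul_sum_smul {ι : Type*} (J : Finset ι) (a : ℂ) (b : ι → ℂ) (x : ι → PeriodSymbol →₀ ℂ) :
    a • ∑ j ∈ J, b j • x j = ∑ j ∈ J, (a * b j) • x j := by
  rw [Finset.smul_sum]
  exact Finset.sum_congr rfl fun j _ => smul_smul a (b j) (x j)

/-- Coefficients of `a • Σⱼ bⱼ • δ_{sⱼ}` are algebraic when `a` and the `bⱼ` are. [folklore] -/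
theorem isAlgebraic_apply_of_eq {ι : Type*} (J : Finset ι) (b : ι → ℂ) (sym : ι → PeriodSymbol)
    (hb : ∀ j ∈ J, IsAlgebraic ℚ (b j)) {a : ℂ} (ha : IsAlgebraic ℚ a) (ρ : PeriodSymbol →₀ ℂ)
    (hρ : ρ = ∑ j ∈ J, b j • Finsupp.single (sym j) (1 : ℂ)) (s : PeriodSymbol) :
    IsAlgebraic ℚ ((a • ρ) s) := by
  rw [Finsupp.smul_apply, smul_eq_mul, hρ]
  exact ha.mul (RetractionAlgebra.isAlgebraic_finset_sum_apply J _
    (fun j hj s' => RetractionAlgebra.isAlgebraic_smul_single_apply (hb j hj) _ _) s)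

end Retraction

/-- **Stub `stub_retraction`** of line `nash-retraction-thin-strip` (crux `RealOnePeriodRelations`):
the retraction `Θ` exists, kills every `ℚ̄`-combination of elementary relations modulo `M₁`, and
agrees with realisations along semialgebraic symbol paths (module docstring).
[cite: HuberWustholz2022, Thm 13.3 (2)] -/
theorem stub_retraction :
    (∀ (Z : CurveData), Z.IsSmoothAffineCurve → ∀ γ : CurvePath Z, ∃ γ' : CurvePath Z,
      IsSemialgebraicMapOn ℚ {z : Fin 1 → ℝ | z 0 ∈ Set.Icc (0 : ℝ) 1}
        (fun z => Fin.append (fun i => (γ'.toFun (z 0) i).re) (fun i => (γ'.toFun (z 0) i).im)) ∧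
      ∃ (x y : Z.points) (p p' : Path x y), (∀ t : I, γ.toFun t = p t) ∧ (∀ t : I, γ'.toFun t = p' t) ∧
        p.Homotopic p') →
    (∀ (Z : CurveData) (hZ : Z.IsSmoothAffineCurve) (ω : Fin Z.n → MvPolynomial (Fin Z.n) ℂ),
      (∀ i, HasAlgCoeffs (ω i)) → ∀ (a : ℂ), IsAlgebraic ℚ a →
      ∀ (γ₀ γ₁ : CurvePath Z),
        IsSemialgebraicMapOn ℚ {z : Fin 1 → ℝ | z 0 ∈ Set.Icc (0 : ℝ) 1}
          (fun z => Fin.append (fun i => (γ₀.toFun (z 0) i).re) (fun i => (γ₀.toFun (z 0) i).im)) →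
        IsSemialgebraicMapOn ℚ {z : Fin 1 → ℝ | z 0 ∈ Set.Icc (0 : ℝ) 1}
          (fun z => Fin.append (fun i => (γ₁.toFun (z 0) i).re) (fun i => (γ₁.toFun (z 0) i).im)) →
        (∃ (x y : Z.points) (p₀ p₁ : Path x y), (∀ t : I, γ₀.toFun t = p₀ t) ∧ (∀ t : I, γ₁.toFun t = p₁ t) ∧
          p₀.Homotopic p₁) →
      ∀ (r₀ r₁ : KZ.IntegralRep 1),
        (r₀.domain = {z | z 0 ∈ Set.Ioo (0 : ℝ) 1} ∧ ∀ z ∈ r₀.domain, r₀.integrand z =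
          (a * ∑ i, MvPolynomial.eval (γ₀.toFun (z 0)) (ω i) * deriv (fun u => γ₀.toFun u i) (z 0)).re) →
        (r₁.domain = {z | z 0 ∈ Set.Ioo (0 : ℝ) 1} ∧ ∀ z ∈ r₁.domain, r₁.integrand z =
          (a * ∑ i, MvPolynomial.eval (γ₁.toFun (z 0)) (ω i) * deriv (fun u => γ₁.toFun u i) (z 0)).re) →
        KZ.of r₀ - KZ.of r₁ ∈ M₁) →
    (∀ (u : ℝ → ℝ), IsSemialgebraicFunOn ℚ {z : Fin 1 → ℝ | z 0 ∈ Set.Icc (0 : ℝ) 1} (fun z => u (z 0)) →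
      ContDiffOn ℝ 1 u (Set.Icc (0 : ℝ) 1) →
      ∀ (r r' : KZ.IntegralRep 1), r.domain = {z | z 0 ∈ Set.Ioo (0 : ℝ) 1} →
        r'.domain = {z | z 0 ∈ Set.Ioo (0 : ℝ) 1} →
        (∀ z ∈ r.domain, r.integrand z = deriv u (z 0)) → (∀ z ∈ r'.domain, r'.integrand z = u 1 - u 0) →
        KZ.of r - KZ.of r' ∈ M₁) →
    (∀ (Z : CurveData) (γ : CurvePath Z),
      IsSemialgebraicMapOn ℚ {z : Fin 1 → ℝ | z 0 ∈ Set.Icc (0 : ℝ) 1}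
        (fun z => Fin.append (fun i => (γ.toFun (z 0) i).re) (fun i => (γ.toFun (z 0) i).im)) →
      ∀ (ω : Fin Z.n → MvPolynomial (Fin Z.n) ℂ), (∀ i, HasAlgCoeffs (ω i)) → ∀ (a : ℂ), IsAlgebraic ℚ a →
      ∃ r : KZ.IntegralRep 1, r.domain = {z | z 0 ∈ Set.Ioo (0 : ℝ) 1} ∧ ∀ z ∈ r.domain, r.integrand z =
        (a * ∑ i, MvPolynomial.eval (γ.toFun (z 0)) (ω i) * deriv (fun u => γ.toFun u i) (z 0)).re) →
    ∃ Θ : ℂ → PeriodSymbol → KZ.FormalRep,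
      (∀ (k : ℕ) (ρ : Fin k → (PeriodSymbol →₀ ℂ)) (a : Fin k → ℂ), (∀ l, IsElementaryRelation (ρ l)) →
        (∀ l, IsAlgebraic ℚ (a l)) → ((∑ l, a l • ρ l).sum fun s b => Θ b s) ∈ M₁) ∧
      (∀ (s : PeriodSymbol) (a : ℂ), IsAlgebraic ℚ a →
        IsSemialgebraicMapOn ℚ {z : Fin 1 → ℝ | z 0 ∈ Set.Icc (0 : ℝ) 1}
          (fun z => Fin.append (fun i => (s.γ.toFun (z 0) i).re) (fun i => (s.γ.toFun (z 0) i).im)) →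
        ∀ (r : KZ.IntegralRep 1),
          (r.domain = {z | z 0 ∈ Set.Ioo (0 : ℝ) 1} ∧ ∀ z ∈ r.domain, r.integrand z =
            (a * ∑ i, MvPolynomial.eval (s.γ.toFun (z 0)) (s.ω i) * deriv (fun u => s.γ.toFun u i) (z 0)).re) →
          Θ a s - KZ.of r ∈ M₁) := by
  intro hrep hcoh hexact hreal
  classical
  ------------------------------------------------------------------
  -- Step 0: the choices — representatives `rep`, realisations `R`, and `Θ`
  ------------------------------------------------------------------
  choose rep hrepSA hrepH using hrep
  have hR : ∀ (s : PeriodSymbol) (a : ℂ), IsAlgebraic ℚ a → ∃ r : KZ.IntegralRep 1,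
      r.domain = {z | z 0 ∈ Set.Ioo (0 : ℝ) 1} ∧ ∀ z ∈ r.domain, r.integrand z =
        (a * ∑ i, MvPolynomial.eval ((rep s.Z s.smooth s.γ).toFun (z 0)) (s.ω i) *
          deriv (fun u => (rep s.Z s.smooth s.γ).toFun u i) (z 0)).re :=
    fun s a ha => hreal s.Z (rep s.Z s.smooth s.γ) (hrepSA s.Z s.smooth s.γ) s.ω s.ω_algebraic a ha
  choose R hR using hR
  let Θ : ℂ → PeriodSymbol → KZ.FormalRep := fun a s => if ha : IsAlgebraic ℚ a then KZ.of (R s a ha) else 0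
  have hΘ : ∀ (s : PeriodSymbol) (a : ℂ) (ha : IsAlgebraic ℚ a), Θ a s = KZ.of (R s a ha) :=
    fun s a ha => dif_pos ha
  ------------------------------------------------------------------
  -- Step 1: `Θ` kills `0` and is additive in the scalar (along the common representative)
  ------------------------------------------------------------------
  have hΘ0 : ∀ s, Θ 0 s ∈ M₁ := fun s => by
    rw [hΘ s 0 isAlgebraic_zero]
    exact RetractionAlgebra.realises_zero_scalar _ s.ω _ (hR s 0 isAlgebraic_zero)
  have hΘadd : ∀ (s : PeriodSymbol) (b₁ b₂ : ℂ), IsAlgebraic ℚ b₁ → IsAlgebraic ℚ b₂ →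
      Θ (b₁ + b₂) s - Θ b₁ s - Θ b₂ s ∈ M₁ := fun s b₁ b₂ h₁ h₂ => by
    rw [hΘ s _ (h₁.add h₂), hΘ s _ h₁, hΘ s _ h₂]
    exact RetractionAlgebra.realises_add_scalar _ s.ω b₁ b₂ _ _ _ (hR s _ (h₁.add h₂)) (hR s _ h₁) (hR s _ h₂)
  -- the class map
  let π : KZ.FormalRep →+ KZ.FormalRep ⧸ M₁ := QuotientAddGroup.mk' M₁
  have hπ0 : ∀ x : KZ.FormalRep, π x = 0 ↔ x ∈ M₁ := fun x => QuotientAddGroup.eq_zero_iff x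
  have hneg : ∀ (s : PeriodSymbol) (b : ℂ), IsAlgebraic ℚ b → π (Θ (-b) s) = -π (Θ b s) := by
    intro s b hb
    have h1 := hΘadd s b (-b) hb hb.neg
    rw [add_neg_cancel] at h1
    have h2 : Θ b s + Θ (-b) s ∈ M₁ := by
      have := M₁.sub_mem (hΘ0 s) h1
      have he : Θ 0 s - (Θ 0 s - Θ b s - Θ (-b) s) = Θ b s + Θ (-b) s := by abel
      rwa [he] at this
    have h3 : π (Θ b s) + π (Θ (-b) s) = 0 := by rw [← map_add, hπ0]; exact h2
    exact eq_neg_of_add_eq_zero_right h3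
  ------------------------------------------------------------------
  -- Step 2: one scaled elementary relation is killed
  ------------------------------------------------------------------
  have hkill : ∀ (ρ : PeriodSymbol →₀ ℂ), IsElementaryRelation ρ → ∀ (a : ℂ), IsAlgebraic ℚ a →
      (∀ s, IsAlgebraic ℚ ((a • ρ) s)) ∧ π ((a • ρ).sum fun s b => Θ b s) = 0 := by
    intro ρ hρ a ha
    cases hρ with
    | add Z hZ γ ω ω₁ ω₂ h h₁ h₂ hω =>
      subst hω
      -- `a • ρ = a•δ_S + (−a)•δ_{S₁} + (−a)•δ_{S₂}`
      set S : PeriodSymbol := ⟨Z, hZ, ω₁ + ω₂, h, γ⟩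
      set S₁ : PeriodSymbol := ⟨Z, hZ, ω₁, h₁, γ⟩
      set S₂ : PeriodSymbol := ⟨Z, hZ, ω₂, h₂, γ⟩
      have hρeq : Finsupp.single S (1 : ℂ) - Finsupp.single S₁ 1 - Finsupp.single S₂ 1 =
          ∑ j : Fin 3, (![1, -1, -1] : Fin 3 → ℂ) j • Finsupp.single ((![S, S₁, S₂] : Fin 3 → PeriodSymbol) j) (1 : ℂ) := by
        simp [Fin.sum_univ_three, sub_eq_add_neg]
      have hb : ∀ j ∈ (Finset.univ : Finset (Fin 3)), IsAlgebraic ℚ ((![1, -1, -1] : Fin 3 → ℂ) j) := by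
        intro j _
        fin_cases j <;> simp [isAlgebraic_one, isAlgebraic_one.neg]
      refine ⟨Retraction.isAlgebraic_apply_of_eq _ _ _ hb ha _ hρeq, ?_⟩
      rw [hρeq, Retraction.smul_sum_smul,
        RetractionAlgebra.mk_sum_of_eq_sum_smul_single Θ hΘ0 hΘadd Finset.univ (fun j => a * (![1, -1, -1] : Fin 3 → ℂ) j)
          ![S, S₁, S₂] (fun j hj => ha.mul (hb j hj)) _ rfl]
      simp only [Fin.sum_univ_three, Matrix.cons_val_zero, Matrix.cons_val_one, Matrix.cons_val,
        mul_one, mul_neg]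
      rw [hneg S₁ a ha, hneg S₂ a ha, ← sub_eq_add_neg, ← sub_eq_add_neg, ← map_sub, ← map_sub, hπ0,
        hΘ S a ha, hΘ S₁ a ha, hΘ S₂ a ha]
      exact RetractionAlgebra.realises_add_form (rep Z hZ γ).toFun ω₁ ω₂ a _ _ _ (hR S a ha) (hR S₁ a ha) (hR S₂ a ha)
    | smul Z hZ γ a' ha' ω ω' h h' hω =>
      subst hω
      set S : PeriodSymbol := ⟨Z, hZ, ω, h, γ⟩
      set S' : PeriodSymbol := ⟨Z, hZ, a' • ω, h', γ⟩
      have hρeq : Finsupp.single S' (1 : ℂ) - a' • Finsupp.single S 1 =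
          ∑ j : Fin 2, (![1, -a'] : Fin 2 → ℂ) j • Finsupp.single ((![S', S] : Fin 2 → PeriodSymbol) j) (1 : ℂ) := by
        simp [Fin.sum_univ_two, sub_eq_add_neg]
      have hb : ∀ j ∈ (Finset.univ : Finset (Fin 2)), IsAlgebraic ℚ ((![1, -a'] : Fin 2 → ℂ) j) := by
        intro j _
        fin_cases j <;> simp [isAlgebraic_one, ha'.neg]
      refine ⟨Retraction.isAlgebraic_apply_of_eq _ _ _ hb ha _ hρeq, ?_⟩
      rw [hρeq, Retraction.smul_sum_smul,
        RetractionAlgebra.mk_sum_of_eq_sum_smul_single Θ hΘ0 hΘadd Finset.univ (fun j => a * (![1, -a'] : Fin 2 → ℂ) j)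
          ![S', S] (fun j hj => ha.mul (hb j hj)) _ rfl]
      simp only [Fin.sum_univ_two, Matrix.cons_val_zero, Matrix.cons_val_one, mul_one, mul_neg]
      rw [hneg S (a * a') (ha.mul ha'), ← sub_eq_add_neg, ← map_sub, hπ0, hΘ S' a ha, hΘ S (a * a') (ha.mul ha')]
      refine RetractionAlgebra.realises_smul_form (rep Z hZ γ).toFun ω a' a _ _ (hR S' a ha)
        ⟨(hR S (a * a') (ha.mul ha')).1, fun z hz => ?_⟩
      rw [(hR S (a * a') (ha.mul ha')).2 z hz, mul_comm a a']
    | vanish Z hZ γ ω h hv =>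
      set S : PeriodSymbol := ⟨Z, hZ, ω, h, γ⟩
      have hρeq : Finsupp.single S (1 : ℂ) =
          ∑ j : Fin 1, (![1] : Fin 1 → ℂ) j • Finsupp.single ((![S] : Fin 1 → PeriodSymbol) j) (1 : ℂ) := by
        simp
      have hb : ∀ j ∈ (Finset.univ : Finset (Fin 1)), IsAlgebraic ℚ ((![1] : Fin 1 → ℂ) j) := by
        intro j _
        fin_cases j; simp [isAlgebraic_one]
      refine ⟨Retraction.isAlgebraic_apply_of_eq _ _ _ hb ha _ hρeq, ?_⟩
      rw [hρeq, Retraction.smul_sum_smul,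
        RetractionAlgebra.mk_sum_of_eq_sum_smul_single Θ hΘ0 hΘadd Finset.univ (fun j => a * (![1] : Fin 1 → ℂ) j)
          ![S] (fun j hj => ha.mul (hb j hj)) _ rfl]
      simp only [Fin.sum_univ_one, Matrix.cons_val_zero, mul_one]
      rw [hπ0, hΘ S a ha]
      exact RetractionAlgebra.realises_vanish (rep Z hZ γ) ω hv a _ (hR S a ha)
    | exact Z hZ γ P hP ω h hω =>
      subst hω
      set S : PeriodSymbol := ⟨Z, hZ, formD P, h, γ⟩
      set e : ℂ := MvPolynomial.eval (γ.toFun 1) P - MvPolynomial.eval (γ.toFun 0) P with he_def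
      have he_alg : IsAlgebraic ℚ e := (hP.isAlgebraic_eval γ.algebraic_one).sub (hP.isAlgebraic_eval γ.algebraic_zero)
      have hρeq : Finsupp.single S (1 : ℂ) - e • Finsupp.single PeriodSymbol.unit 1 =
          ∑ j : Fin 2, (![1, -e] : Fin 2 → ℂ) j • Finsupp.single ((![S, PeriodSymbol.unit] : Fin 2 → PeriodSymbol) j) (1 : ℂ) := by
        simp [Fin.sum_univ_two, sub_eq_add_neg]
      have hb : ∀ j ∈ (Finset.univ : Finset (Fin 2)), IsAlgebraic ℚ ((![1, -e] : Fin 2 → ℂ) j) := by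
        intro j _
        fin_cases j <;> simp [isAlgebraic_one, he_alg.neg]
      refine ⟨Retraction.isAlgebraic_apply_of_eq _ _ _ hb ha _ hρeq, ?_⟩
      rw [hρeq, Retraction.smul_sum_smul,
        RetractionAlgebra.mk_sum_of_eq_sum_smul_single Θ hΘ0 hΘadd Finset.univ (fun j => a * (![1, -e] : Fin 2 → ℂ) j)
          ![S, PeriodSymbol.unit] (fun j hj => ha.mul (hb j hj)) _ rfl]
      simp only [Fin.sum_univ_two, Matrix.cons_val_zero, Matrix.cons_val_one, mul_one, mul_neg]
      rw [hneg PeriodSymbol.unit (a * e) (ha.mul he_alg), ← sub_eq_add_neg, ← map_sub, hπ0, hΘ S a ha,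
        hΘ PeriodSymbol.unit (a * e) (ha.mul he_alg)]
      -- end points of the representative agree with those of `γ`
      have hends := RetractionCases.endpoints_of_homotopic (hrepH Z hZ γ)
      refine RetractionCases.exact_case hcoh hexact P hP a ha (rep Z hZ γ) (hrepSA Z hZ γ)
        (rep CurveData.affineLine CurveData.isSmoothAffineCurve_affineLine unitPath)
        (hrepSA _ _ _) (RetractionPaths.homotopic_symm (hrepH _ _ _)) _ _ (hR S a ha)
        ⟨(hR PeriodSymbol.unit (a * e) (ha.mul he_alg)).1, fun z hz => ?_⟩
      rw [(hR PeriodSymbol.unit (a * e) (ha.mul he_alg)).2 z hz, he_def, hends.1, hends.2]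
      rfl
    | pushforward Z Z' hZ hZ' f hf hfZ ω' h' ω h hω γ γ' hγ' =>
      subst hω
      set S : PeriodSymbol := ⟨Z, hZ, formPullback f ω', h, γ⟩
      set S' : PeriodSymbol := ⟨Z', hZ', ω', h', γ'⟩
      have hρeq : Finsupp.single S (1 : ℂ) - Finsupp.single S' 1 =
          ∑ j : Fin 2, (![1, -1] : Fin 2 → ℂ) j • Finsupp.single ((![S, S'] : Fin 2 → PeriodSymbol) j) (1 : ℂ) := by
        simp [Fin.sum_univ_two, sub_eq_add_neg]
      have hb : ∀ j ∈ (Finset.univ : Finset (Fin 2)), IsAlgebraic ℚ ((![1, -1] : Fin 2 → ℂ) j) := by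
        intro j _
        fin_cases j <;> simp [isAlgebraic_one, isAlgebraic_one.neg]
      refine ⟨Retraction.isAlgebraic_apply_of_eq _ _ _ hb ha _ hρeq, ?_⟩
      rw [hρeq, Retraction.smul_sum_smul,
        RetractionAlgebra.mk_sum_of_eq_sum_smul_single Θ hΘ0 hΘadd Finset.univ (fun j => a * (![1, -1] : Fin 2 → ℂ) j)
          ![S, S'] (fun j hj => ha.mul (hb j hj)) _ rfl]
      simp only [Fin.sum_univ_two, Matrix.cons_val_zero, Matrix.cons_val_one, mul_one, mul_neg]
      rw [hneg S' a ha, ← sub_eq_add_neg, ← map_sub, hπ0, hΘ S a ha, hΘ S' a ha]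
      -- the homotopy `f ∘ rep γ ≃ rep γ'`: through `f ∘ γ = γ'` on `[0,1]`
      have hhom : ∀ δ : CurvePath Z', (∀ t, δ.toFun t = fun j => eval ((rep Z hZ γ).toFun t) (f j)) →
          ∃ (x y : Z'.points) (p p' : Path x y), (∀ t : I, δ.toFun t = p t) ∧
            (∀ t : I, (rep Z' hZ' γ').toFun t = p' t) ∧ p.Homotopic p' := by
        intro δ hδ
        obtain ⟨δ₀, hδ₀⟩ := RetractionPaths.exists_mapPath f hf hfZ γ
        -- `δ ≃ δ₀` (image of `rep γ ≃ γ`), `δ₀ = γ'` on `[0,1]`, `γ' ≃ rep γ'`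
        have h1 := RetractionPaths.homotopic_map f hfZ (RetractionPaths.homotopic_symm (hrepH Z hZ γ)) δ δ₀
          (fun t _ => hδ t) (fun t _ => hδ₀ t)
        have h2 := RetractionPaths.homotopic_of_eqOn δ₀ γ' fun t ht => by rw [hδ₀ t, hγ' t ht]
        exact RetractionPaths.homotopic_trans (RetractionPaths.homotopic_trans h1 h2) (hrepH Z' hZ' γ')
      exact RetractionCases.pushforward_case hcoh hreal hZ' f hf hfZ ω' h' a ha (rep Z hZ γ) (hrepSA Z hZ γ)
        (rep Z' hZ' γ') (hrepSA Z' hZ' γ') hhom _ _ (hR S a ha) (hR S' a ha)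
    | boundary Z hZ ω h τ hτ hτZ e₀₁ e₁₂ e₀₂ h₀₁ h₁₂ h₀₂ =>
      set S₀₁ : PeriodSymbol := ⟨Z, hZ, ω, h, e₀₁⟩
      set S₁₂ : PeriodSymbol := ⟨Z, hZ, ω, h, e₁₂⟩
      set S₀₂ : PeriodSymbol := ⟨Z, hZ, ω, h, e₀₂⟩
      have hρeq : Finsupp.single S₀₁ (1 : ℂ) + Finsupp.single S₁₂ 1 - Finsupp.single S₀₂ 1 =
          ∑ j : Fin 3, (![1, 1, -1] : Fin 3 → ℂ) j • Finsupp.single ((![S₀₁, S₁₂, S₀₂] : Fin 3 → PeriodSymbol) j) (1 : ℂ) := by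
        simp [Fin.sum_univ_three, sub_eq_add_neg]
      have hb : ∀ j ∈ (Finset.univ : Finset (Fin 3)), IsAlgebraic ℚ ((![1, 1, -1] : Fin 3 → ℂ) j) := by
        intro j _
        fin_cases j <;> simp [isAlgebraic_one, isAlgebraic_one.neg]
      refine ⟨Retraction.isAlgebraic_apply_of_eq _ _ _ hb ha _ hρeq, ?_⟩
      rw [hρeq, Retraction.smul_sum_smul,
        RetractionAlgebra.mk_sum_of_eq_sum_smul_single Θ hΘ0 hΘadd Finset.univ (fun j => a * (![1, 1, -1] : Fin 3 → ℂ) j)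
          ![S₀₁, S₁₂, S₀₂] (fun j hj => ha.mul (hb j hj)) _ rfl]
      simp only [Fin.sum_univ_three, Matrix.cons_val_zero, Matrix.cons_val_one, Matrix.cons_val,
        mul_one, mul_neg]
      rw [hneg S₀₂ a ha, ← sub_eq_add_neg, ← map_add, ← map_sub, hπ0, hΘ S₀₁ a ha, hΘ S₁₂ a ha, hΘ S₀₂ a ha]
      -- junctions
      have hI0 : (0 : ℝ) ∈ Icc (0 : ℝ) 1 := ⟨le_rfl, zero_le_one⟩
      have hI1 : (1 : ℝ) ∈ Icc (0 : ℝ) 1 := ⟨zero_le_one, le_rfl⟩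
      have hj : e₀₁.toFun 1 = e₁₂.toFun 0 := by rw [h₀₁ 1 hI1, h₁₂ 0 hI0, sub_zero]
      have hends₀₁ := RetractionCases.endpoints_of_homotopic (hrepH Z hZ e₀₁)
      have hends₁₂ := RetractionCases.endpoints_of_homotopic (hrepH Z hZ e₁₂)
      have hj' : (rep Z hZ e₀₁).toFun 1 = (rep Z hZ e₁₂).toFun 0 := by
        rw [← hends₀₁.2, ← hends₁₂.1, hj]
      -- `rep e₀₁ ⋆ rep e₁₂ ≃ e₀₁ ⋆ e₁₂ ≃ e₀₂ ≃ rep e₀₂`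
      have hhom : ∃ (x y : Z.points) (p p' : Path x y), (∀ t : I, ((rep Z hZ e₀₁).concat (rep Z hZ e₁₂) hj').toFun t = p t) ∧
          (∀ t : I, (rep Z hZ e₀₂).toFun t = p' t) ∧ p.Homotopic p' := by
        have h1 := RetractionConcat.homotopic_concat hj' hj (RetractionPaths.homotopic_symm (hrepH Z hZ e₀₁))
          (RetractionPaths.homotopic_symm (hrepH Z hZ e₁₂))
        have h2 := RetractionPaths.homotopic_symm (RetractionConcat.homotopic_triangle τ hτ.continuousOn hτZ e₀₁ e₁₂ e₀₂ h₀₁ h₁₂ h₀₂ hj)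
        exact RetractionPaths.homotopic_trans (RetractionPaths.homotopic_trans h1 h2) (hrepH Z hZ e₀₂)
      exact RetractionCases.boundary_case hcoh hreal hZ ω h a ha (rep Z hZ e₀₁) (rep Z hZ e₁₂) (rep Z hZ e₀₂) hj'
        (hrepSA _ _ _) (hrepSA _ _ _) (hrepSA _ _ _) hhom _ _ _ (hR S₀₁ a ha) (hR S₁₂ a ha) (hR S₀₂ a ha)
  ------------------------------------------------------------------
  -- Step 3: conclusion
  ------------------------------------------------------------------
  refine ⟨Θ, fun k ρ a hρ ha => ?_, fun s a ha hSA r hr => ?_⟩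
  · exact RetractionAlgebra.sum_mem_M₁_of_forall Θ hΘ0 hΘadd ρ a (fun l s => ((hkill (ρ l) (hρ l) (a l) (ha l)).1 s))
      fun l => (hkill (ρ l) (hρ l) (a l) (ha l)).2
  · rw [hΘ s a ha]
    exact hcoh s.Z s.smooth s.ω s.ω_algebraic a ha (rep s.Z s.smooth s.γ) s.γ (hrepSA _ _ _) hSA
      (RetractionPaths.homotopic_symm (hrepH _ _ _)) _ r (hR s a ha) hr

end Summit.KontsevichZagierPeriods.SymplecticScissors.RealOnePeriodRelations

end
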